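import Mathlib
import HarnessLib
import Summits.Ventures.LatticeQCDFlow.Scoring.RegenerativeTourCovariance

/-!
# Tours of the split chain, IX: moments WEIGHTED AT THE REGENERATION TIME — a bounded functional of
# the past, read off when tour `j + 1` starts, factors out of every moment of that tour

HONEST FRAMING: exact (Metropolis-corrected) sampling algorithms for lattice gauge theory;
figures of merit are autocorrelation/cost numbers at stated couplings and volumes; no
continuum-physics claim.

Venture `LatticeQCDFlow` (cell pub-lqcd), topic `Scoring`; FANOUT row 8 (`s0-cpn-nemc`, GEN-18).
NEW WORK of the cell, not a published result; no definition is introduced.  Notation of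
`Scoring/SplitChainTours.lean` / `Scoring/RegenerativeTourCovariance.lean`: head count `K_t`, tour
sums `S^h_i = ∑' u, 1{K_u = i} h(X_u)`, the `(j+1)`-th regeneration time `τ_{j+1}`
(`{τ_{j+1} = t + 1} = {K_t = j} ∩ {coin_{t+1}}`), split chain `P̂` from ANY initial law, fresh
chain `P̂_ν̂`.  A WEIGHT AT THE REGENERATION TIME is `W_{τ_{j+1} − 1}` for a family `W_t` of
bounded measurable functionals with `DependsOn (W t) (Set.Iic t)`, written without stopping times as
the almost surely single-term series `∑' t, 1{K_t = j} · 1{coin_{t+1}} · W_t`.  Two factorisations,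
both instances of the random-time regeneration theorem of `Scoring/SplitChainStrongMarkov.lean`
(the second with the unbounded past weight `S^{h₁}_i`, handled exactly as in
`Scoring/RegenerativeTourCovariance.lean`):
(i) `E[W_{τ−1} · Λ(S^{h₂}_{j+1})] = E[W_{τ−1}] · E_ν̂[Λ(S^{h₂}_0)]` for measurable `Λ` with
`Λ(S^{h₂}_0)` integrable under the fresh chain (e.g. the square);
(ii) `E[S^{h₁}_i · W_{τ−1} · S^{h₂}_{j+1}] = E[S^{h₁}_i · W_{τ−1}] · E_ν̂[S^{h₂}_0]` for `i ≤ j`.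
These are the second-moment inputs of the Anscombe step of the Markov-chain CLT
(`Scoring/SplitChainAnscombe.lean`): with `W` the indicator that the regeneration happens before a
fixed time, the centred tour sums weighted by "started before time `n`" stay orthogonal.
Printed counterpart NAMED ONLY: Wald's identities for regenerative processes (Asmussen 2003 VI.1) —
nothing is cited as a fact.

## Content (`0 < ε < 1`, any initial law, `h₁ h₂` bounded measurable, `|W_t| ≤ 1` past-measurable)

* **`splitChain_tour_weighted_law`** — (i) above;
* **`splitChain_tour_crossMoment_weighted`** — (ii) above, with integrability of the triple product.

NOT CLAIMED: unbounded weights `W`; functionals of a tour looking beyond its last update.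
-/

noncomputable section

namespace Summit.Ventures.LatticeQCDFlow.Scoring

open MeasureTheory ProbabilityTheory Filter Finset Preorder Literature.Probability.MarkovChains
open scoped ENNReal

section Weighted

variable {Ω : Type*} [MeasurableSpace Ω]
  {κ : Kernel Ω Ω} [IsMarkovKernel κ] {ν : Measure Ω} [IsProbabilityMeasure ν] {ε : ℝ≥0∞}
  {hmin : ∀ x {B : Set Ω}, MeasurableSet B → ε * ν B ≤ κ x B}
  (κs : Kernel (Ω × Bool) (Ω × Bool)) [IsMarkovKernel κs]
  (μs : Measure (Ω × Bool)) [IsProbabilityMeasure μs]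

omit [IsMarkovKernel κs] [IsProbabilityMeasure μs] in
/-- The weight at the regeneration time, `∑' t, 1{K_t = j} 1{coin_{t+1}} W_t`, is measurable and
bounded by `1` in absolute value (at most one term is nonzero). -/
theorem weightAtRegeneration_measurable_abs_le {W : ℕ → (ℕ → Ω × Bool) → ℝ} (hWm : ∀ t, Measurable (W t))
    (hWd : ∀ t, DependsOn (W t) (Set.Iic t)) (hWC : ∀ t x, |W t x| ≤ 1) (j : ℕ) :
    Measurable (fun x : ℕ → Ω × Bool => (∑' t, (if (∑ s ∈ Finset.range t, (if (x (s + 1)).2 then (1 : ℕ) else 0)) = j then (1 : ℝ) else 0) * (if (x (t + 1)).2 then (1 : ℝ) else 0) * W t x))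
    ∧ ∀ x : ℕ → Ω × Bool, |(∑' t, (if (∑ s ∈ Finset.range t, (if (x (s + 1)).2 then (1 : ℕ) else 0)) = j then (1 : ℝ) else 0) * (if (x (t + 1)).2 then (1 : ℝ) else 0) * W t x)| ≤ 1 := by
  have _ := hWd
  refine ⟨Measurable.tsum fun t => ((measurable_headCountIndicator t j).mul
    (measurable_coinHeads (t + 1))).mul (hWm t), fun x => ?_⟩
  by_cases hex : ∃ t, (∑ s ∈ Finset.range t, (if (x (s + 1)).2 then (1 : ℕ) else 0)) = j ∧ (x (t + 1)).2 = true
  · obtain ⟨t₀, ht₀, hh₀⟩ := hex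
    rw [tsum_eq_single t₀]
    · rw [if_pos ht₀, if_pos hh₀, one_mul, one_mul]; exact hWC t₀ x
    · intro t hne
      by_cases h1 : (∑ s ∈ Finset.range t, (if (x (s + 1)).2 then (1 : ℕ) else 0)) = j
      · have h2 : ¬ (x (t + 1)).2 = true := fun h2 => hne (tourStart_unique x h1 h2 ht₀ hh₀)
        rw [if_neg h2, mul_zero, zero_mul]
      · rw [if_neg h1, zero_mul, zero_mul]
  · push Not at hex
    have h0 : ∀ t, (if (∑ s ∈ Finset.range t, (if (x (s + 1)).2 then (1 : ℕ) else 0)) = j then (1 : ℝ) else 0) * (if (x (t + 1)).2 then (1 : ℝ) else 0) * W t x = 0 := fun t => by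
      by_cases h1 : (∑ s ∈ Finset.range t, (if (x (s + 1)).2 then (1 : ℕ) else 0)) = j
      · rw [if_neg (hex t h1), mul_zero, zero_mul]
      · rw [if_neg h1, zero_mul, zero_mul]
    rw [tsum_congr h0, tsum_zero, abs_zero]
    exact zero_le_one

/-- **WEIGHTED TOUR LAW**: `0 < ε < 1`, any initial law, `|W_t| ≤ 1` past-measurable, `h₂`
jointly... `h₂ : Ω → ℝ` measurable, `Λ : ℝ → ℝ` measurable with `Λ(S^{h₂}_0)` integrable under
`P̂_ν̂`.  Then `E[W_{τ_{j+1}−1} · Λ(S^{h₂}_{j+1})] = E[W_{τ_{j+1}−1}] · E_ν̂[Λ(S^{h₂}_0)]`. -/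
theorem splitChain_tour_weighted_law (hε0 : 0 < ε) (hε : ε < 1)
    (hκs : ∀ p, κs p = (ε • ν).map (fun y : Ω => (y, true))
      + ((1 - ε) • Doeblin.residualKernel κ ν ε hmin p.1).map (fun y : Ω => (y, false)))
    {W : ℕ → (ℕ → Ω × Bool) → ℝ} (hWm : ∀ t, Measurable (W t))
    (hWd : ∀ t, DependsOn (W t) (Set.Iic t)) (hWC : ∀ t x, |W t x| ≤ 1)
    {h₂ : Ω → ℝ} (hh₂ : Measurable h₂) {Λ : ℝ → ℝ} (hΛ : Measurable Λ)
    (hΛi : Integrable (fun y : ℕ → Ω × Bool => Λ (∑' u, (if (∑ s ∈ Finset.range u, (if (y (s + 1)).2 then (1 : ℕ) else 0)) = 0 then (1 : ℝ) else 0) * h₂ (y u).1))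
      (Kernel.trajMeasure (X := fun _ : ℕ => Ω × Bool) (ν.map (fun y : Ω => (y, true)))
        (fun n : ℕ => κs.comap (fun h : (i : ↥(Finset.Iic n)) → Ω × Bool =>
          h ⟨n, Finset.mem_Iic.2 le_rfl⟩) (measurable_pi_apply _)))) (j : ℕ) :
    ∫ x, (∑' t, (if (∑ s ∈ Finset.range t, (if (x (s + 1)).2 then (1 : ℕ) else 0)) = j then (1 : ℝ) else 0) * (if (x (t + 1)).2 then (1 : ℝ) else 0) * W t x)
        * Λ (∑' u, (if (∑ s ∈ Finset.range u, (if (x (s + 1)).2 then (1 : ℕ) else 0)) = j + 1 then (1 : ℝ) else 0) * h₂ (x u).1) ∂(Kernel.trajMeasure (X := fun _ : ℕ => Ω × Bool) μs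
        (fun n : ℕ => κs.comap (fun h : (i : ↥(Finset.Iic n)) → Ω × Bool =>
          h ⟨n, Finset.mem_Iic.2 le_rfl⟩) (measurable_pi_apply _)))
      = (∫ x, (∑' t, (if (∑ s ∈ Finset.range t, (if (x (s + 1)).2 then (1 : ℕ) else 0)) = j then (1 : ℝ) else 0) * (if (x (t + 1)).2 then (1 : ℝ) else 0) * W t x) ∂(Kernel.trajMeasure (X := fun _ : ℕ => Ω × Bool) μs
        (fun n : ℕ => κs.comap (fun h : (i : ↥(Finset.Iic n)) → Ω × Bool =>
          h ⟨n, Finset.mem_Iic.2 le_rfl⟩) (measurable_pi_apply _))))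
        * ∫ y, Λ (∑' u, (if (∑ s ∈ Finset.range u, (if (y (s + 1)).2 then (1 : ℕ) else 0)) = 0 then (1 : ℝ) else 0) * h₂ (y u).1) ∂(Kernel.trajMeasure (X := fun _ : ℕ => Ω × Bool) (ν.map (fun y : Ω => (y, true)))
        (fun n : ℕ => κs.comap (fun h : (i : ↥(Finset.Iic n)) → Ω × Bool =>
          h ⟨n, Finset.mem_Iic.2 le_rfl⟩) (measurable_pi_apply _))) := by
  haveI hνt : IsProbabilityMeasure (ν.map (fun y : Ω => (y, true))) :=
    Measure.isProbabilityMeasure_map (measurable_tagCoin true).aemeasurable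
  set P := (Kernel.trajMeasure (X := fun _ : ℕ => Ω × Bool) μs
        (fun n : ℕ => κs.comap (fun h : (i : ↥(Finset.Iic n)) → Ω × Bool =>
          h ⟨n, Finset.mem_Iic.2 le_rfl⟩) (measurable_pi_apply _))) with hP
  set Pν := (Kernel.trajMeasure (X := fun _ : ℕ => Ω × Bool) (ν.map (fun y : Ω => (y, true)))
        (fun n : ℕ => κs.comap (fun h : (i : ↥(Finset.Iic n)) → Ω × Bool =>
          h ⟨n, Finset.mem_Iic.2 le_rfl⟩) (measurable_pi_apply _))) with hPν
  have hψ₂ : Measurable fun pq : (Ω × Bool) × (Ω × Bool) => h₂ pq.1.1 :=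
    hh₂.comp (measurable_fst.comp measurable_fst)
  have hHm : Measurable fun y : ℕ → Ω × Bool => Λ (∑' u, (if (∑ s ∈ Finset.range u, (if (y (s + 1)).2 then (1 : ℕ) else 0)) = 0 then (1 : ℝ) else 0) * h₂ (y u).1) :=
    hΛ.comp (measurable_tourSum (Ω := Ω) (ψ := fun p _ => h₂ p.1) hψ₂ 0)
  have key := splitChain_tour_regeneration κs μs (κ := κ) (ν := ν) (hmin := hmin) hε hκs j hWm hWd
    (C := 1) hWC hHm hΛi
  rw [← hP, ← hPν] at key
  have hae := splitChain_ae_tourStart κs μs (κ := κ) (ν := ν) (hmin := hmin) hε0 hε hκs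
  rw [← hP] at hae
  have hzero : ∀ (x : ℕ → Ω × Bool) (t₀ : ℕ), (∑ s ∈ Finset.range t₀, (if (x (s + 1)).2 then (1 : ℕ) else 0)) = j → (x (t₀ + 1)).2 = true →
      ∀ (w : ℕ → ℝ) (t : ℕ), t ≠ t₀ →
      W t x * (if (∑ s ∈ Finset.range t, (if (x (s + 1)).2 then (1 : ℕ) else 0)) = j then (1 : ℝ) else 0) * (if (x (t + 1)).2 then (1 : ℝ) else 0) * w t = 0 := by
    intro x t₀ ht₀ hh₀ w t hne
    by_cases h1 : (∑ s ∈ Finset.range t, (if (x (s + 1)).2 then (1 : ℕ) else 0)) = j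
    · have h2 : ¬ (x (t + 1)).2 = true := fun h2 => hne (tourStart_unique x h1 h2 ht₀ hh₀)
      rw [if_neg h2, mul_zero, zero_mul]
    · rw [if_neg h1, mul_zero, zero_mul, zero_mul]
  -- a.s.: the weighted series times the transported functional is the product in the statement
  have hid1 : ∀ᵐ x ∂P, (∑' t, W t x * (if (∑ s ∈ Finset.range t, (if (x (s + 1)).2 then (1 : ℕ) else 0)) = j then (1 : ℝ) else 0) * (if (x (t + 1)).2 then (1 : ℝ) else 0)
        * Λ (∑' u, (if (∑ s ∈ Finset.range u, (if (x (t + 1 + (s + 1))).2 then (1 : ℕ) else 0)) = 0 then (1 : ℝ) else 0) * h₂ (x (t + 1 + u)).1))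
      = (∑' t, (if (∑ s ∈ Finset.range t, (if (x (s + 1)).2 then (1 : ℕ) else 0)) = j then (1 : ℝ) else 0) * (if (x (t + 1)).2 then (1 : ℝ) else 0) * W t x) * Λ (∑' u, (if (∑ s ∈ Finset.range u, (if (x (s + 1)).2 then (1 : ℕ) else 0)) = j + 1 then (1 : ℝ) else 0) * h₂ (x u).1) := by
    filter_upwards [hae] with x hx
    obtain ⟨t₀, ht₀, hh₀⟩ := hx j
    have hw0 : ∀ t, t ≠ t₀ → (if (∑ s ∈ Finset.range t, (if (x (s + 1)).2 then (1 : ℕ) else 0)) = j then (1 : ℝ) else 0) * (if (x (t + 1)).2 then (1 : ℝ) else 0) * W t x = 0 := fun t hne => by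
      have h := hzero x t₀ ht₀ hh₀ (fun _ => 1) t hne
      rw [mul_one] at h
      rw [mul_comm ((if (∑ s ∈ Finset.range t, (if (x (s + 1)).2 then (1 : ℕ) else 0)) = j then (1 : ℝ) else 0) * (if (x (t + 1)).2 then (1 : ℝ) else 0)) (W t x), ← mul_assoc]
      exact h
    rw [tsum_eq_single t₀ (hzero x t₀ ht₀ hh₀ _), tsum_eq_single t₀ hw0, if_pos ht₀, if_pos hh₀,
      mul_one, mul_one, one_mul, one_mul, ← tourSum_transport (fun p _ => h₂ p.1) x ht₀ hh₀]
  have hid2 : ∀ᵐ x ∂P, (∑' t, W t x * (if (∑ s ∈ Finset.range t, (if (x (s + 1)).2 then (1 : ℕ) else 0)) = j then (1 : ℝ) else 0) * (if (x (t + 1)).2 then (1 : ℝ) else 0))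
      = (∑' t, (if (∑ s ∈ Finset.range t, (if (x (s + 1)).2 then (1 : ℕ) else 0)) = j then (1 : ℝ) else 0) * (if (x (t + 1)).2 then (1 : ℝ) else 0) * W t x) := by
    refine ae_of_all _ fun x => tsum_congr fun t => ?_
    ring
  rw [← integral_congr_ae hid1, key, integral_congr_ae hid2]

/-- **WEIGHTED CROSS MOMENTS FACTORISE**: `0 < ε < 1`, any initial law, `h₁, h₂` bounded measurable,
`|W_t| ≤ 1` past-measurable, `i ≤ j`.  Then `S^{h₁}_i · W_{τ_{j+1}−1} · S^{h₂}_{j+1}` is integrable and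
`E[S^{h₁}_i · W_{τ_{j+1}−1} · S^{h₂}_{j+1}] = E[S^{h₁}_i · W_{τ_{j+1}−1}] · E_ν̂[S^{h₂}_0]`. -/
theorem splitChain_tour_crossMoment_weighted (hε0 : 0 < ε) (hε : ε < 1)
    (hκs : ∀ p, κs p = (ε • ν).map (fun y : Ω => (y, true))
      + ((1 - ε) • Doeblin.residualKernel κ ν ε hmin p.1).map (fun y : Ω => (y, false)))
    {W : ℕ → (ℕ → Ω × Bool) → ℝ} (hWm : ∀ t, Measurable (W t))
    (hWd : ∀ t, DependsOn (W t) (Set.Iic t)) (hWC : ∀ t x, |W t x| ≤ 1)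
    {h₁ h₂ : Ω → ℝ} (hh₁ : Measurable h₁) (hh₂ : Measurable h₂) {C₁ C₂ : ℝ}
    (hC₁ : ∀ y, |h₁ y| ≤ C₁) (hC₂ : ∀ y, |h₂ y| ≤ C₂) {i j : ℕ} (hij : i ≤ j) :
    Integrable (fun x : ℕ → Ω × Bool =>
        (∑' u, (if (∑ s ∈ Finset.range u, (if (x (s + 1)).2 then (1 : ℕ) else 0)) = i then (1 : ℝ) else 0) * h₁ (x u).1) * (∑' t, (if (∑ s ∈ Finset.range t, (if (x (s + 1)).2 then (1 : ℕ) else 0)) = j then (1 : ℝ) else 0) * (if (x (t + 1)).2 then (1 : ℝ) else 0) * W t x)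
        * (∑' u, (if (∑ s ∈ Finset.range u, (if (x (s + 1)).2 then (1 : ℕ) else 0)) = j + 1 then (1 : ℝ) else 0) * h₂ (x u).1)) (Kernel.trajMeasure (X := fun _ : ℕ => Ω × Bool) μs
        (fun n : ℕ => κs.comap (fun h : (i : ↥(Finset.Iic n)) → Ω × Bool =>
          h ⟨n, Finset.mem_Iic.2 le_rfl⟩) (measurable_pi_apply _)))
    ∧ ∫ x, (∑' u, (if (∑ s ∈ Finset.range u, (if (x (s + 1)).2 then (1 : ℕ) else 0)) = i then (1 : ℝ) else 0) * h₁ (x u).1) * (∑' t, (if (∑ s ∈ Finset.range t, (if (x (s + 1)).2 then (1 : ℕ) else 0)) = j then (1 : ℝ) else 0) * (if (x (t + 1)).2 then (1 : ℝ) else 0) * W t x)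
        * (∑' u, (if (∑ s ∈ Finset.range u, (if (x (s + 1)).2 then (1 : ℕ) else 0)) = j + 1 then (1 : ℝ) else 0) * h₂ (x u).1) ∂(Kernel.trajMeasure (X := fun _ : ℕ => Ω × Bool) μs
        (fun n : ℕ => κs.comap (fun h : (i : ↥(Finset.Iic n)) → Ω × Bool =>
          h ⟨n, Finset.mem_Iic.2 le_rfl⟩) (measurable_pi_apply _)))
      = (∫ x, (∑' u, (if (∑ s ∈ Finset.range u, (if (x (s + 1)).2 then (1 : ℕ) else 0)) = i then (1 : ℝ) else 0) * h₁ (x u).1) * (∑' t, (if (∑ s ∈ Finset.range t, (if (x (s + 1)).2 then (1 : ℕ) else 0)) = j then (1 : ℝ) else 0) * (if (x (t + 1)).2 then (1 : ℝ) else 0) * W t x) ∂(Kernel.trajMeasure (X := fun _ : ℕ => Ω × Bool) μs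
        (fun n : ℕ => κs.comap (fun h : (i : ↥(Finset.Iic n)) → Ω × Bool =>
          h ⟨n, Finset.mem_Iic.2 le_rfl⟩) (measurable_pi_apply _))))
        * ∫ y, (∑' u, (if (∑ s ∈ Finset.range u, (if (y (s + 1)).2 then (1 : ℕ) else 0)) = 0 then (1 : ℝ) else 0) * h₂ (y u).1) ∂(Kernel.trajMeasure (X := fun _ : ℕ => Ω × Bool) (ν.map (fun y : Ω => (y, true)))
        (fun n : ℕ => κs.comap (fun h : (i : ↥(Finset.Iic n)) → Ω × Bool =>
          h ⟨n, Finset.mem_Iic.2 le_rfl⟩) (measurable_pi_apply _))) := by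
  haveI hνt : IsProbabilityMeasure (ν.map (fun y : Ω => (y, true))) :=
    Measure.isProbabilityMeasure_map (measurable_tagCoin true).aemeasurable
  set P := (Kernel.trajMeasure (X := fun _ : ℕ => Ω × Bool) μs
        (fun n : ℕ => κs.comap (fun h : (i : ↥(Finset.Iic n)) → Ω × Bool =>
          h ⟨n, Finset.mem_Iic.2 le_rfl⟩) (measurable_pi_apply _))) with hP
  set Pν := (Kernel.trajMeasure (X := fun _ : ℕ => Ω × Bool) (ν.map (fun y : Ω => (y, true)))
        (fun n : ℕ => κs.comap (fun h : (i : ↥(Finset.Iic n)) → Ω × Bool =>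
          h ⟨n, Finset.mem_Iic.2 le_rfl⟩) (measurable_pi_apply _))) with hPν
  have hC₁0 : 0 ≤ C₁ := (abs_nonneg _).trans (hC₁ (Classical.choice (nonempty_of_isProbabilityMeasure ν)))
  -- the past weights `G_t = 1{K_t = j} · S^{h₁,≤t}_i · W_t`
  have hGm : ∀ t, Measurable fun x : ℕ → Ω × Bool =>
      (if (∑ s ∈ Finset.range t, (if (x (s + 1)).2 then (1 : ℕ) else 0)) = j then (1 : ℝ) else 0) * (∑ u ∈ Finset.range (t + 1), (if (∑ s ∈ Finset.range u, (if (x (s + 1)).2 then (1 : ℕ) else 0)) = i then (1 : ℝ) else 0) * h₁ (x u).1) * W t x := fun t =>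
    ((measurable_headCountIndicator t j).mul (Finset.measurable_sum _ fun u _ =>
      (measurable_headCountIndicator u i).mul (hh₁.comp (measurable_fst.comp (measurable_pi_apply u))))).mul
      (hWm t)
  have hKdep : ∀ (u t : ℕ), u ≤ t → ∀ (x y : ℕ → Ω × Bool), (∀ n ∈ Set.Iic t, x n = y n) →
      (∑ s ∈ Finset.range u, (if (x (s + 1)).2 then (1 : ℕ) else 0)) = (∑ s ∈ Finset.range u, (if (y (s + 1)).2 then (1 : ℕ) else 0)) := by
    intro u t hut x y hxy
    exact Finset.sum_congr rfl fun s hs => by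
      rw [hxy (s + 1) (Set.mem_Iic.2 (by have := Finset.mem_range.1 hs; omega))]
  have hGd : ∀ t, DependsOn (fun x : ℕ → Ω × Bool =>
      (if (∑ s ∈ Finset.range t, (if (x (s + 1)).2 then (1 : ℕ) else 0)) = j then (1 : ℝ) else 0) * (∑ u ∈ Finset.range (t + 1), (if (∑ s ∈ Finset.range u, (if (x (s + 1)).2 then (1 : ℕ) else 0)) = i then (1 : ℝ) else 0) * h₁ (x u).1) * W t x) (Set.Iic t) := by
    intro t x y hxy
    show _ * _ * _ = _ * _ * _
    rw [hKdep t t le_rfl x y hxy, hWd t hxy]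
    congr 2
    exact Finset.sum_congr rfl fun u hu => by
      have hut : u ≤ t := by have := Finset.mem_range.1 hu; omega
      rw [hKdep u t hut x y hxy, hxy u (Set.mem_Iic.2 hut)]
  have hSfin : ∀ (t : ℕ) (x : ℕ → Ω × Bool), |(∑ u ∈ Finset.range (t + 1), (if (∑ s ∈ Finset.range u, (if (x (s + 1)).2 then (1 : ℕ) else 0)) = i then (1 : ℝ) else 0) * h₁ (x u).1)| ≤ C₁ * (t + 1) := by
    intro t x
    refine (Finset.abs_sum_le_sum_abs _ _).trans ?_
    calc ∑ u ∈ Finset.range (t + 1), |(if (∑ s ∈ Finset.range u, (if (x (s + 1)).2 then (1 : ℕ) else 0)) = i then (1 : ℝ) else 0) * h₁ (x u).1|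
        ≤ ∑ u ∈ Finset.range (t + 1), C₁ := Finset.sum_le_sum fun u _ => by
          rw [abs_mul]
          calc _ ≤ 1 * C₁ := mul_le_mul (by split_ifs <;> simp) (hC₁ _) (abs_nonneg _) zero_le_one
            _ = C₁ := one_mul _
      _ = C₁ * (t + 1) := by
        rw [Finset.sum_const, Finset.card_range, nsmul_eq_mul]; push_cast; ring
  have hGC : ∀ (t : ℕ) (x : ℕ → Ω × Bool),
      |(if (∑ s ∈ Finset.range t, (if (x (s + 1)).2 then (1 : ℕ) else 0)) = j then (1 : ℝ) else 0) * (∑ u ∈ Finset.range (t + 1), (if (∑ s ∈ Finset.range u, (if (x (s + 1)).2 then (1 : ℕ) else 0)) = i then (1 : ℝ) else 0) * h₁ (x u).1) * W t x| ≤ C₁ * (t + 1) := by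
    intro t x
    rw [abs_mul, abs_mul]
    have h1 : |(if (∑ s ∈ Finset.range t, (if (x (s + 1)).2 then (1 : ℕ) else 0)) = j then (1 : ℝ) else 0)| ≤ 1 := by split_ifs <;> simp
    calc _ ≤ 1 * (C₁ * (t + 1)) * 1 :=
        mul_le_mul (mul_le_mul h1 (hSfin t x) (abs_nonneg _) zero_le_one) (hWC t x) (abs_nonneg _)
          (by positivity)
      _ = C₁ * (t + 1) := by ring
  -- the future functional `S^{h₂}_0`
  have hψ₂ : Measurable fun pq : (Ω × Bool) × (Ω × Bool) => h₂ pq.1.1 :=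
    hh₂.comp (measurable_fst.comp measurable_fst)
  have hHm := measurable_tourSum (Ω := Ω) (ψ := fun p _ => h₂ p.1) hψ₂ 0
  have hHi := splitChain_integrable_tourSum κs (ν.map (fun y : Ω => (y, true))) (κ := κ) (ν := ν)
    (hmin := hmin) hε0 hε hκs hh₂ hC₂ 0
  rw [← hPν] at hHi
  have hNi := splitChain_integrable_tourSum κs μs (κ := κ) (ν := ν) (hmin := hmin) hε0 hε hκs
    (h := fun _ => (1 : ℝ)) measurable_const (C := 1) (fun _ => by simp) i
  rw [← hP] at hNi
  simp only [mul_one] at hNi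
  have hae := splitChain_ae_tourStart κs μs (κ := κ) (ν := ν) (hmin := hmin) hε0 hε hκs
  rw [← hP] at hae
  -- summability of the weights: partial sums `≤ C₁ E[N_i]`
  have hsum : Summable fun t : ℕ => ∫ x, |(if (∑ s ∈ Finset.range t, (if (x (s + 1)).2 then (1 : ℕ) else 0)) = j then (1 : ℝ) else 0) * (∑ u ∈ Finset.range (t + 1), (if (∑ s ∈ Finset.range u, (if (x (s + 1)).2 then (1 : ℕ) else 0)) = i then (1 : ℝ) else 0) * h₁ (x u).1) * W t x|
      * (if (x (t + 1)).2 then (1 : ℝ) else 0) ∂P := by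
    have hint : ∀ t, Integrable (fun x : ℕ → Ω × Bool => |(if (∑ s ∈ Finset.range t, (if (x (s + 1)).2 then (1 : ℕ) else 0)) = j then (1 : ℝ) else 0)
        * (∑ u ∈ Finset.range (t + 1), (if (∑ s ∈ Finset.range u, (if (x (s + 1)).2 then (1 : ℕ) else 0)) = i then (1 : ℝ) else 0) * h₁ (x u).1) * W t x| * (if (x (t + 1)).2 then (1 : ℝ) else 0)) P := fun t => by
      refine integrable_of_bounded P ((hGm t).abs.mul (measurable_coinHeads (t + 1)))
        (C := C₁ * (t + 1) * 1) fun x => ?_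
      rw [abs_mul, abs_abs]
      exact mul_le_mul (hGC t x) (by split_ifs <;> simp) (abs_nonneg _) (by positivity)
    refine summable_of_sum_range_le (c := C₁ * ∫ x, (∑' u, (if (∑ s ∈ Finset.range u, (if (x (s + 1)).2 then (1 : ℕ) else 0)) = i then (1 : ℝ) else 0)) ∂P)
      (fun t => integral_nonneg fun x => mul_nonneg (abs_nonneg _) (by split_ifs <;> norm_num))
      fun n => ?_
    rw [← integral_finsetSum _ fun t _ => hint t, ← integral_const_mul]
    refine integral_mono_ae (integrable_finsetSum _ fun t _ => hint t) (hNi.const_mul C₁) ?_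
    filter_upwards [hae] with x hx
    obtain ⟨t₀, ht₀, hh₀⟩ := hx j
    have hterm : ∀ t, |(if (∑ s ∈ Finset.range t, (if (x (s + 1)).2 then (1 : ℕ) else 0)) = j then (1 : ℝ) else 0) * (∑ u ∈ Finset.range (t + 1), (if (∑ s ∈ Finset.range u, (if (x (s + 1)).2 then (1 : ℕ) else 0)) = i then (1 : ℝ) else 0) * h₁ (x u).1) * W t x| * (if (x (t + 1)).2 then (1 : ℝ) else 0)
        ≤ if t = t₀ then C₁ * (∑' u, (if (∑ s ∈ Finset.range u, (if (x (s + 1)).2 then (1 : ℕ) else 0)) = i then (1 : ℝ) else 0)) else 0 := by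
      intro t
      by_cases h1 : (∑ s ∈ Finset.range t, (if (x (s + 1)).2 then (1 : ℕ) else 0)) = j
      · by_cases h2 : (x (t + 1)).2 = true
        · have ht : t = t₀ := tourStart_unique x h1 h2 ht₀ hh₀
          rw [if_pos ht, if_pos h1, if_pos h2, one_mul, mul_one, abs_mul,
            ← tourSum_eq_finsetSum (fun p _ => h₁ p.1) x hij h1 h2]
          calc _ ≤ |(∑' u, (if (∑ s ∈ Finset.range u, (if (x (s + 1)).2 then (1 : ℕ) else 0)) = i then (1 : ℝ) else 0) * h₁ (x u).1)| * 1 :=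
              mul_le_mul_of_nonneg_left (hWC t x) (abs_nonneg _)
            _ ≤ _ := by
              rw [mul_one]
              exact abs_tourSum_le_tourLength (ψ := fun p _ => h₁ p.1) (fun p _ => hC₁ p.1) x hij h1 h2
        · rw [if_neg h2, mul_zero]; split_ifs <;> positivity
      · rw [if_neg h1, zero_mul, zero_mul, abs_zero, zero_mul]; split_ifs <;> positivity
    calc _ ≤ ∑ t ∈ Finset.range n, (if t = t₀ then C₁ * (∑' u, (if (∑ s ∈ Finset.range u, (if (x (s + 1)).2 then (1 : ℕ) else 0)) = i then (1 : ℝ) else 0)) else 0) :=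
          Finset.sum_le_sum fun t _ => hterm t
      _ ≤ _ := by
          rw [Finset.sum_ite_eq']
          split_ifs
          · exact le_rfl
          · exact mul_nonneg hC₁0 (tsum_nonneg fun u => by split_ifs <;> norm_num)
  -- the random-time regeneration theorem at `τ_{j+1}` with these weights
  have key := splitChain_regeneration_randomTime κs μs (κ := κ) (ν := ν) (hmin := hmin) hε hκs hGm
    hGd hGC hHm hHi hsum
  have hTi := splitChain_regeneration_randomTime_integrable κs μs (κ := κ) (ν := ν) (hmin := hmin)
    hε hκs hGm hGd hGC hHm hHi hsum
  rw [← hP] at key hTi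
  beta_reduce at key hTi
  -- pathwise identifications on the almost sure set where tour `j + 1` starts
  have hzero : ∀ (x : ℕ → Ω × Bool) (t₀ : ℕ), (∑ s ∈ Finset.range t₀, (if (x (s + 1)).2 then (1 : ℕ) else 0)) = j → (x (t₀ + 1)).2 = true →
      ∀ (w : ℕ → ℝ) (t : ℕ), t ≠ t₀ →
      (if (∑ s ∈ Finset.range t, (if (x (s + 1)).2 then (1 : ℕ) else 0)) = j then (1 : ℝ) else 0) * (∑ u ∈ Finset.range (t + 1), (if (∑ s ∈ Finset.range u, (if (x (s + 1)).2 then (1 : ℕ) else 0)) = i then (1 : ℝ) else 0) * h₁ (x u).1) * W t x * (if (x (t + 1)).2 then (1 : ℝ) else 0) * w t = 0 := by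
    intro x t₀ ht₀ hh₀ w t hne
    by_cases h1 : (∑ s ∈ Finset.range t, (if (x (s + 1)).2 then (1 : ℕ) else 0)) = j
    · have h2 : ¬ (x (t + 1)).2 = true := fun h2 => hne (tourStart_unique x h1 h2 ht₀ hh₀)
      rw [if_neg h2, mul_zero, zero_mul]
    · rw [if_neg h1, zero_mul, zero_mul, zero_mul, zero_mul]
  have hwzero : ∀ (x : ℕ → Ω × Bool) (t₀ : ℕ), (∑ s ∈ Finset.range t₀, (if (x (s + 1)).2 then (1 : ℕ) else 0)) = j → (x (t₀ + 1)).2 = true →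
      ∀ (t : ℕ), t ≠ t₀ → (if (∑ s ∈ Finset.range t, (if (x (s + 1)).2 then (1 : ℕ) else 0)) = j then (1 : ℝ) else 0) * (if (x (t + 1)).2 then (1 : ℝ) else 0) * W t x = 0 := by
    intro x t₀ ht₀ hh₀ t hne
    by_cases h1 : (∑ s ∈ Finset.range t, (if (x (s + 1)).2 then (1 : ℕ) else 0)) = j
    · have h2 : ¬ (x (t + 1)).2 = true := fun h2 => hne (tourStart_unique x h1 h2 ht₀ hh₀)
      rw [if_neg h2, mul_zero, zero_mul]
    · rw [if_neg h1, zero_mul, zero_mul]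
  have hpath : ∀ᵐ x ∂P, (∑' t, (if (∑ s ∈ Finset.range t, (if (x (s + 1)).2 then (1 : ℕ) else 0)) = j then (1 : ℝ) else 0) * (∑ u ∈ Finset.range (t + 1), (if (∑ s ∈ Finset.range u, (if (x (s + 1)).2 then (1 : ℕ) else 0)) = i then (1 : ℝ) else 0) * h₁ (x u).1) * W t x
        * (if (x (t + 1)).2 then (1 : ℝ) else 0) * (∑' u, (if (∑ s ∈ Finset.range u, (if (x (t + 1 + (s + 1))).2 then (1 : ℕ) else 0)) = 0 then (1 : ℝ) else 0) * h₂ (x (t + 1 + u)).1))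
      = (∑' u, (if (∑ s ∈ Finset.range u, (if (x (s + 1)).2 then (1 : ℕ) else 0)) = i then (1 : ℝ) else 0) * h₁ (x u).1) * (∑' t, (if (∑ s ∈ Finset.range t, (if (x (s + 1)).2 then (1 : ℕ) else 0)) = j then (1 : ℝ) else 0) * (if (x (t + 1)).2 then (1 : ℝ) else 0) * W t x) * (∑' u, (if (∑ s ∈ Finset.range u, (if (x (s + 1)).2 then (1 : ℕ) else 0)) = j + 1 then (1 : ℝ) else 0) * h₂ (x u).1) := by
    filter_upwards [hae] with x hx
    obtain ⟨t₀, ht₀, hh₀⟩ := hx j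
    rw [tsum_eq_single t₀ (hzero x t₀ ht₀ hh₀ _), tsum_eq_single t₀ (hwzero x t₀ ht₀ hh₀),
      if_pos ht₀, if_pos hh₀, one_mul, mul_one, one_mul, one_mul,
      ← tourSum_eq_finsetSum (fun p _ => h₁ p.1) x hij ht₀ hh₀,
      ← tourSum_transport (fun p _ => h₂ p.1) x ht₀ hh₀]
  have hpath' : ∀ᵐ x ∂P, (∑' t, (if (∑ s ∈ Finset.range t, (if (x (s + 1)).2 then (1 : ℕ) else 0)) = j then (1 : ℝ) else 0) * (∑ u ∈ Finset.range (t + 1), (if (∑ s ∈ Finset.range u, (if (x (s + 1)).2 then (1 : ℕ) else 0)) = i then (1 : ℝ) else 0) * h₁ (x u).1) * W t x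
        * (if (x (t + 1)).2 then (1 : ℝ) else 0))
      = (∑' u, (if (∑ s ∈ Finset.range u, (if (x (s + 1)).2 then (1 : ℕ) else 0)) = i then (1 : ℝ) else 0) * h₁ (x u).1) * (∑' t, (if (∑ s ∈ Finset.range t, (if (x (s + 1)).2 then (1 : ℕ) else 0)) = j then (1 : ℝ) else 0) * (if (x (t + 1)).2 then (1 : ℝ) else 0) * W t x) := by
    filter_upwards [hae] with x hx
    obtain ⟨t₀, ht₀, hh₀⟩ := hx j
    have h0 := hzero x t₀ ht₀ hh₀ (fun _ => 1)
    simp only [mul_one] at h0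
    rw [tsum_eq_single t₀ h0, tsum_eq_single t₀ (hwzero x t₀ ht₀ hh₀), if_pos ht₀, if_pos hh₀,
      one_mul, mul_one, one_mul, one_mul, ← tourSum_eq_finsetSum (fun p _ => h₁ p.1) x hij ht₀ hh₀]
  -- `∑' ∫ (weights) = ∫ S^{h₁}_i · W`
  have hint' : ∀ t, Integrable (fun x : ℕ → Ω × Bool => (if (∑ s ∈ Finset.range t, (if (x (s + 1)).2 then (1 : ℕ) else 0)) = j then (1 : ℝ) else 0)
      * (∑ u ∈ Finset.range (t + 1), (if (∑ s ∈ Finset.range u, (if (x (s + 1)).2 then (1 : ℕ) else 0)) = i then (1 : ℝ) else 0) * h₁ (x u).1) * W t x * (if (x (t + 1)).2 then (1 : ℝ) else 0)) P := fun t => by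
    refine integrable_of_bounded P ((hGm t).mul (measurable_coinHeads (t + 1)))
      (C := C₁ * (t + 1) * 1) fun x => ?_
    rw [abs_mul]
    exact mul_le_mul (hGC t x) (by split_ifs <;> simp) (abs_nonneg _) (by positivity)
  have hsum' : Summable fun t : ℕ => ∫ x, ‖(if (∑ s ∈ Finset.range t, (if (x (s + 1)).2 then (1 : ℕ) else 0)) = j then (1 : ℝ) else 0) * (∑ u ∈ Finset.range (t + 1), (if (∑ s ∈ Finset.range u, (if (x (s + 1)).2 then (1 : ℕ) else 0)) = i then (1 : ℝ) else 0) * h₁ (x u).1) * W t x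
      * (if (x (t + 1)).2 then (1 : ℝ) else 0)‖ ∂P := by
    refine hsum.congr fun t => integral_congr_ae (ae_of_all _ fun x => ?_)
    beta_reduce
    rw [Real.norm_eq_abs, abs_mul _ (if (x (t + 1)).2 then (1 : ℝ) else 0)]
    congr 1
    exact (abs_of_nonneg (by split_ifs <;> norm_num)).symm
  have hGsum : (∑' t, ∫ x, (if (∑ s ∈ Finset.range t, (if (x (s + 1)).2 then (1 : ℕ) else 0)) = j then (1 : ℝ) else 0) * (∑ u ∈ Finset.range (t + 1), (if (∑ s ∈ Finset.range u, (if (x (s + 1)).2 then (1 : ℕ) else 0)) = i then (1 : ℝ) else 0) * h₁ (x u).1) * W t x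
      * (if (x (t + 1)).2 then (1 : ℝ) else 0) ∂P)
      = ∫ x, (∑' u, (if (∑ s ∈ Finset.range u, (if (x (s + 1)).2 then (1 : ℕ) else 0)) = i then (1 : ℝ) else 0) * h₁ (x u).1) * (∑' t, (if (∑ s ∈ Finset.range t, (if (x (s + 1)).2 then (1 : ℕ) else 0)) = j then (1 : ℝ) else 0) * (if (x (t + 1)).2 then (1 : ℝ) else 0) * W t x) ∂P := by
    rw [integral_tsum_of_summable_integral_norm hint' hsum']
    exact integral_congr_ae hpath'
  refine ⟨hTi.congr hpath, ?_⟩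
  rw [← integral_congr_ae hpath, key, hGsum]

end Weighted

end Summit.Ventures.LatticeQCDFlow.Scoring

end
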